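import Summits.BirchSwinnertonDyer.BirchSwinnertonDyer.Theorems.AdditiveBranchIMCMultLowerCongruence
import Summits.BirchSwinnertonDyer.Rank1Residual.Additive.SemistableTwistAnalytic
import Summits.BirchSwinnertonDyer.Rank1Residual.Additive.SemistableTwistAnalyticOdd
import Summits.BirchSwinnertonDyer.Rank1Residual.Additive.RamifiedTwistMinimality
import Summits.BirchSwinnertonDyer.Rank1Residual.Additive.X3RankZeroSemistableTwistOdd
import Summits.BirchSwinnertonDyer.Rank1Residual.Additive.ChiBranchConstantTerm
import Summits.BirchSwinnertonDyer.Rank1Residual.Additive.ChiBranchConstantTermOdd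
import Summits.BirchSwinnertonDyer.Rank1Residual.Additive.XMultRankZeroCyclotomicThreeFacts
import Summits.BirchSwinnertonDyer.Rank1Residual.Additive.XSplitMultRankZeroCyclotomicThreeFacts
import Summits.BirchSwinnertonDyer.Rank1Residual.Additive.XMultRankZeroCyclotomicPrimePrep
import HarnessLib

/-!
# Crux `MultLower` (item 19359) / child `MultLambdaLower` (item 19590), the EPW branch road on cell (M):
# the base-case certificate (C2) READ OFF AN `L`-VALUE — the partner's `p*`-twist is a rank-`0` additive
# pair whose algebraic `L`-value `L(E₁,1)/Ω_{E₁}` is a `p`-adic unit (sequel of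
# `AdditiveBranchIMCMultLowerCongruence`; the (M) / semistable-partner twin of k1-c2's
# `AdditiveBranchIMCGordTwoRankZeroCongruenceCert`, BOTH parities)

Cell `bsd-addord`, seat `bsd-addord-k1-c4` (D-0074 row B3), gen 3. HONEST FRAMING: as in the parent file —
theorems only, every published input a named-fact binder (`hKW`, `hEPW`, `hPal`, `hmod`, the route's facts),
the certificates displayed and never asserted; closes nothing, books nothing; BSD is not proved here.

WHAT. The parent file's certificate (C2) at a SEMISTABLE partner `V₁` (good ordinary or multiplicative at
`p`) is «the constant term of `ϖ₁·B` has `p`-adic norm `1`», `B` the `ω^{(p−1)/2}`-branch of the measure of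
`V₁`'s reduction type (two-term unit-root branch / one-term `a = ±1` branch; plus or minus symbols by the
parity of `(p−1)/2`). By the branch constant terms (MTT §I.14; tree theorems
`constantCoeff_padicLFunction[Minus]Branch_half` = `α₁⁻¹·∑(a/p)[a/p]^±_f`,
`constantCoeff_padicLFunctionPlusBranchMult_half` / `…MinusBranchMult_half_of_[non]split` =
`±∑(a/p)[a/p]^±_f`) the constant term of `B` has the norm of the Legendre-weighted symbol sum `∑(a/p)[a/p]^±_f`
in ALL THREE reduction types (§0); and by Birch's formula for the `p*`-twist `E₁ = C • V₁^{(p*)}` — even: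
`L(E₁,1) = ±ϖ₁·∑·Ω_{E₁}` with Pal's period theorem (tree `entireLFunction_one_eq_of_twist`, `Good ∨ Mult`);
odd: `L(E₁,1) = ±ϖ₁·∑·Ω_{E₁}/(|u(C)|·c_∞(E₁))` (tree `entireLFunction_one_eq_of_twist_neg`) with
`ord_p u(C) = 0` (tree `padicValRat_u_eq_zero_of_twist_pm_p`, `Good ∨ Mult`) and `c_∞ ∈ {1,2}` — (C2) is
IMPLIED BY the elementary datum

  (C2′)  `E₁ := V₁ ⊗ χ_{p*}` (globally minimal model, additive at `p`) has analytic rank `0` and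
         `ord_p (L(E₁,1)/Ω_{E₁}) = 0`

— one rational number per partner, the rank-`0` BSD quotient every census row already carries. So the road
of the parent file reads, on cell (M): for an additive potentially multiplicative pair `(E, p)`, `p ≥ 5`,
`r_an(E) = 0`, with multiplicative twist model(s) `V`: IF some semistable `V₁` with `ρ_{V₁,pⁿ}` onto (all
`n`) has (C1) `V₁[p] ≅ V[p]` and (C2′) its own `p*`-twist `E₁` — a cell-(M) pair if `V₁` is multiplicative,
a cell-(G-ord, `e = 2`) pair if `V₁` is good ordinary — is a rank-`0` pair with unit algebraic `L`-value,
THEN `ord_p #Ш(E)_an ≤ ord_p #Ш(E)`. In words: the lower half of `BSD(E,p)` PROPAGATES along a mod-`p`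
congruence of twist models from ANY odd-additive semistable-twist pair where it is trivial to the cell-(M)
pairs where it has content — by Emerton–Pollack–Weston on the branch, multiplicative members included.

* §0 `norm_constantCoeff_halfBranch_eq` — `‖B(0)‖ = ‖∑(a/p)[a/p]^±_f‖` in all three reduction types.
* §1 `norm_constantCoeff_halfBranch_eq_one_of_LValueUnit` — (C2′) ⟹ (C2), both parities.
* §2 `quadraticBranchLowerDivisibilityAt_of_partner_LValueUnit` — the Λ-adic input at any congruent
  semistable `V` (in particular the child 19590 AT THE PAIR) from `hKW`, `hEPW`, `hPal`, `hmod`, (C1), (C2′).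
* §3 `missingLowerBoundAt_rankZero_of_cellM_of_partner_LValueUnit` — the lower half at a cell-(M) pair.

References: Emerton–Pollack–Weston 2006 Cor. 5.1.4, Ex. 5.3.1 [EmertonPollackWeston2006]; Kato 2004
Thm. 12.5 (4) [Kato2004Asterisque]; Wuthrich 2014 Thm. 3 [Wuthrich2014]; Mazur–Tate–Teitelbaum 1986
§I.8, §I.10, §I.14 [MazurTateTeitelbaum1986Invent]; Pal 2012 Thm. 3.2 [Pal2012]; Delbourgo 1998 Prop. 4
[Delbourgo1998]; Silverman AEC VII.1 [SilvermanAEC2009]; Miller 2011 Def. 1.1 [Miller2011LMS].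
-/

set_option autoImplicit false
set_option linter.dupNamespace false

noncomputable section

open scoped Classical MatrixGroups ModularForm

open CongruenceSubgroup WeierstrassCurve
  Literature.NumberTheory.EllipticCurves
  Literature.NumberTheory.EllipticCurves.ModularForms
  Literature.NumberTheory.EllipticCurves.Rank1Residual
  Literature.NumberTheory.EllipticCurves.Rank1Residual.Typed
  Literature.NumberTheory.EllipticCurves.GreenbergVatsal2000
  Literature.NumberTheory.EllipticCurves.EmertonPollackWeston2006
  Literature.NumberTheory.GaloisRepresentations

namespace Summit.BirchSwinnertonDyer.BirchSwinnertonDyer.Theorems.AdditiveBranchIMCMultLowerCongruence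

open Summit.BirchSwinnertonDyer.Rank1Residual
open Summit.BirchSwinnertonDyer.Rank1Residual.Additive
open Summit.BirchSwinnertonDyer.Rank1Residual.AdditivePotMult
open Summit.BirchSwinnertonDyer.BirchSwinnertonDyer.Theses.AdditiveBranchIMC
open Summit.BirchSwinnertonDyer.BirchSwinnertonDyer.Theorems.AdditiveBranchIMCMultLower

variable {p : ℕ} [hp : Fact p.Prime]

/-! ## §0 The constant term of the half branch has the norm of the Legendre-weighted symbol sum -/

/-- **`‖B(0)‖_p = ‖∑_{a mod p} (a/p)[a/p]^±_f‖_p` for the `ω^{(p−1)/2}`-branch `B` of a SEMISTABLE curve**,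
in each of the three reduction types of the half-eigen disjunction: good ordinary —
`B(0) = α⁻¹·∑(a/p)[a/p]^±_f` with `α ∈ ℤ_p^×` (`constantCoeff_padicLFunction[Minus]Branch_half`); split
multiplicative — `B(0) = ∑(a/p)[a/p]^±_f`; non-split — `B(0) = −∑(a/p)[a/p]^±_f`
(`constantCoeff_padicLFunctionPlusBranchMult_half`, `…MinusBranchMult_half_of_[non]split`); plus symbols if
`(p−1)/2` is even, minus symbols if odd. Mazur–Tate–Teitelbaum §I.14 with `ε(p) ∈ {1, 0}`.
[cite: MazurTateTeitelbaum1986Invent, §I.10, §I.13–I.14] -/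
theorem norm_constantCoeff_halfBranch_eq (hp2 : p ≠ 2)
    (V₁ : WeierstrassCurve ℚ) [V₁.IsElliptic] [V₁.IsGloballyMinimal]
    {N : ℕ} [NeZero N] {f : CuspForm (Gamma0 N) 2} (hf : IsNewformOf V₁ f) (B : PowerSeries ℚ_[p])
    (hB : (IsOrdinaryAt V₁ p ∧
          B = if Even (p / 2) then padicLFunctionBranch f ((unitRoot V₁ p : ℤ_[p]) : ℚ_[p]) (p / 2)
            else padicLFunctionMinusBranch f ((unitRoot V₁ p : ℤ_[p]) : ℚ_[p]) (p / 2)) ∨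
        (V₁.HasSplitMultiplicativeReductionAtPrime p ∧
          B = if Even (p / 2) then padicLFunctionPlusBranchMult f (1 : ℚ_[p]) (p / 2)
            else padicLFunctionMinusBranchMult f (1 : ℚ_[p]) (p / 2)) ∨
        (V₁.HasMultiplicativeReductionAtPrime p ∧ ¬ V₁.HasSplitMultiplicativeReductionAtPrime p ∧
          B = if Even (p / 2) then padicLFunctionPlusBranchMult f (-1 : ℚ_[p]) (p / 2)
            else padicLFunctionMinusBranchMult f (-1 : ℚ_[p]) (p / 2))) :
    ‖PowerSeries.constantCoeff B‖ =
      ‖(if Even (p / 2) then (legendrePlusSymbolSum f p : ℚ_[p])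
        else (legendreMinusSymbolSum f p : ℚ_[p]))‖ := by
  rcases hB with ⟨hord, rfl⟩ | ⟨hs, rfl⟩ | ⟨hm, hns, rfl⟩
  · -- good ordinary: `B(0) = α⁻¹ ∑`, `‖α‖ = 1`
    obtain ⟨-, hαunit⟩ := unitRoot_spec_holds V₁ p hord
    have hα : ‖((unitRoot V₁ p : ℤ_[p]) : ℚ_[p])‖ = 1 := by
      rw [PadicInt.padic_norm_e_of_padicInt]; exact PadicInt.isUnit_iff.mp hαunit
    split_ifs with he
    · rw [constantCoeff_padicLFunctionBranch_half p hp2 V₁ hord hf, norm_mul, norm_inv, hα, inv_one,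
        one_mul]
    · rw [constantCoeff_padicLFunctionMinusBranch_half p hp2 V₁ hord hf, norm_mul, norm_inv, hα, inv_one,
        one_mul]
  · -- split multiplicative: `a = 1`
    split_ifs with he
    · have hap := (hf.cuspCoeff_eq_one_and_sq_of_split hs).1
      have hpN := hf.dvd_level_of_split hs
      have h := constantCoeff_padicLFunctionPlusBranchMult_half p hp2 hf.1 hf.coeffField_eq_bot hpN
        (ap := 1) (by exact_mod_cast hap) (by norm_num)
      push_cast at h
      rw [h]
      simp
    · rw [constantCoeff_padicLFunctionMinusBranchMult_half_of_split p hp2 V₁ hs hf]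
  · -- non-split multiplicative: `a = −1`
    split_ifs with he
    · obtain ⟨hap, hpN⟩ := hf.cuspCoeff_eq_neg_one_and_dvd_of_nonsplit hm hns
      have h := constantCoeff_padicLFunctionPlusBranchMult_half p hp2 hf.1 hf.coeffField_eq_bot hpN
        (ap := -1) (by exact_mod_cast hap) (by norm_num)
      push_cast at h
      rw [h]
      simp
    · rw [constantCoeff_padicLFunctionMinusBranchMult_half_of_nonsplit p hp2 V₁ hm hns hf, norm_neg]

/-! ## §1 (C2′) ⟹ (C2): a unit algebraic `L`-value of the partner's `p*`-twist gives a unit branch constant term -/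

/-- **(C2′) ⟹ (C2), both parities, semistable partner.** Let `p` be odd, `V₁/ℚ` globally minimal, good
ordinary or multiplicative at `p` (read off the disjunct), `E₁ = C • V₁^{(p*)}` (`p* = (−1)^{(p−1)/2}p`) a
globally minimal curve ADDITIVE at `p` with `r_an(E₁) = 0` and `L(E₁,1) = q·Ω_{E₁}`, `q ∈ ℚ`, `ord_p q = 0`.
Then for every newform / branch / period normalisation `(f, B, ϖ)` of the half-eigen disjunction the constant
term of `ϖ·B` has `p`-adic norm `1`: `‖B(0)‖ = ‖∑(a/p)[a/p]^±_f‖` (§0) and `ϖ·∑ = ±q` (even: Birch + Pal,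
`entireLFunction_one_eq_of_twist`) resp. `±q·|u(C)|·c_∞(E₁)` with `ord_p(|u(C)|·c_∞) = 0` (odd:
`entireLFunction_one_eq_of_twist_neg`, `padicValRat_u_eq_zero_of_twist_pm_p`).
[cite: MazurTateTeitelbaum1986Invent, §I.8, §I.14] [cite: Pal2012, Thm. 3.2] [cite: SilvermanAEC2009, VII.1 Prop. 1.3(b)] -/
theorem norm_constantCoeff_halfBranch_eq_one_of_LValueUnit
    (hPal : Pal2012.thm32_sqrt_mul_realPeriodRat_twist_eq_of_prime_one_mod_four)
    (hmod : hasEntireLFunction_rat) (hp2 : p ≠ 2)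
    (V₁ E₁ : WeierstrassCurve ℚ) [V₁.IsElliptic] [V₁.IsGloballyMinimal] [E₁.IsElliptic]
    [E₁.IsGloballyMinimal]
    (hCW : ∃ C : VariableChange ℚ, C • V₁.quadraticTwist ((-1) ^ (p / 2) * p : ℚ) = E₁)
    (hadd : Addv E₁ p) (hr : E₁.analyticRank = 0)
    (hL : ∃ q : ℚ, E₁.entireLFunction 1 = (q : ℂ) * (E₁.realPeriodRat : ℂ) ∧ padicValRat p q = 0)
    {N : ℕ} [NeZero N] (f : CuspForm (Gamma0 N) 2) (B : PowerSeries ℚ_[p]) (hf : IsNewformOf V₁ f)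
    (hB : (IsOrdinaryAt V₁ p ∧
          B = if Even (p / 2) then padicLFunctionBranch f ((unitRoot V₁ p : ℤ_[p]) : ℚ_[p]) (p / 2)
            else padicLFunctionMinusBranch f ((unitRoot V₁ p : ℤ_[p]) : ℚ_[p]) (p / 2)) ∨
        (V₁.HasSplitMultiplicativeReductionAtPrime p ∧
          B = if Even (p / 2) then padicLFunctionPlusBranchMult f (1 : ℚ_[p]) (p / 2)
            else padicLFunctionMinusBranchMult f (1 : ℚ_[p]) (p / 2)) ∨
        (V₁.HasMultiplicativeReductionAtPrime p ∧ ¬ V₁.HasSplitMultiplicativeReductionAtPrime p ∧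
          B = if Even (p / 2) then padicLFunctionPlusBranchMult f (-1 : ℚ_[p]) (p / 2)
            else padicLFunctionMinusBranchMult f (-1 : ℚ_[p]) (p / 2)))
    (ϖ : ℚ) (hϖ : if Even (p / 2) then (ϖ : ℝ) * V₁.realPeriodRat = plusPeriod f
      else (ϖ : ℝ) * V₁.imaginaryPeriodRat = minusPeriod f) :
    ‖PowerSeries.constantCoeff (PowerSeries.C (ϖ : ℚ_[p]) * B)‖ = 1 := by
  -- the reduction type, in the currency of Birch's formula
  have hV : Good V₁ p ∨ Mult V₁ p := by
    rcases hB with h | h | h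
    · exact Or.inl h.1.1
    · exact Or.inr h.1.hasMultiplicativeReductionAtPrime
    · exact Or.inr h.1
  have hS := norm_constantCoeff_halfBranch_eq hp2 V₁ hf B hB
  obtain ⟨q, hq, hvq⟩ := hL
  have hL0 : E₁.entireLFunction 1 ≠ 0 := (E₁.analyticRank_eq_zero_iff_holds (hmod E₁)).mp hr
  have hΩ : (E₁.realPeriodRat : ℂ) ≠ 0 := by exact_mod_cast (E₁.realPeriodRat_pos_holds).ne'
  have hq0 : q ≠ 0 := by
    rintro rfl
    exact hL0 (by rw [hq]; simp)
  -- it suffices that `ϖ·∑` has valuation `0`, `∑` the symbol sum of the parity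
  suffices hmain : ∃ S : ℚ, (S : ℚ_[p]) = (if Even (p / 2) then (legendrePlusSymbolSum f p : ℚ_[p])
      else (legendreMinusSymbolSum f p : ℚ_[p])) ∧ ϖ * S ≠ 0 ∧ padicValRat p (ϖ * S) = 0 by
    obtain ⟨S, hSS, hϖS0, hval⟩ := hmain
    have hnormϖS : ‖((ϖ * S : ℚ) : ℚ_[p])‖ = 1 := by
      rw [Padic.eq_padicNorm, padicNorm.eq_zpow_of_nonzero hϖS0, hval, neg_zero, zpow_zero]
      push_cast; rfl
    rw [map_mul, PowerSeries.constantCoeff_C, norm_mul, hS, ← hSS, ← norm_mul]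
    have : (ϖ : ℚ_[p]) * (S : ℚ_[p]) = ((ϖ * S : ℚ) : ℚ_[p]) := by push_cast; rfl
    rw [this, hnormϖS]
  have hodd_or : p % 4 = 1 ∨ p % 4 = 3 := by
    obtain ⟨k, hk⟩ := hp.out.odd_of_ne_two hp2
    omega
  rcases hodd_or with hp1 | hp3
  · -- EVEN branch: `p* = p`, Birch + Pal
    have heven : Even (p / 2) := ⟨p / 4, by omega⟩
    have hCW' : ∃ C : VariableChange ℚ, C • V₁.quadraticTwist (p : ℚ) = E₁ := by
      rw [pStar_eq_self_of_mod_four_eq_one hp1] at hCW; exact hCW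
    rw [if_pos heven] at hϖ
    obtain ⟨ε, hε, hLε⟩ := entireLFunction_one_eq_of_twist p hPal hmod hp1 V₁ E₁ hCW' hV hadd hf ϖ hϖ
    have hqε : q = ε * (ϖ * legendrePlusSymbolSum f p) := by
      have h1 : ((q : ℂ)) = ((ε * (ϖ * legendrePlusSymbolSum f p) : ℚ) : ℂ) :=
        mul_right_cancel₀ hΩ (hq.symm.trans hLε)
      exact_mod_cast h1
    have hϖS0 : (ϖ * legendrePlusSymbolSum f p : ℚ) ≠ 0 := by
      intro hz; exact hq0 (by rw [hqε, hz, mul_zero])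
    have hε0 : ε ≠ 0 := by rcases hε with rfl | rfl <;> norm_num
    have hvε : padicValRat p ε = 0 := by
      rcases hε with rfl | rfl
      · exact padicValRat.one
      · rw [← padicValRat.neg, neg_neg]; exact padicValRat.one
    refine ⟨legendrePlusSymbolSum f p, by rw [if_pos heven], hϖS0, ?_⟩
    have := hvq
    rw [hqε, padicValRat.mul hε0 hϖS0, hvε, zero_add] at this
    exact this
  · -- ODD branch: `p* = −p`, odd Birch with the unit factor `|u(C)|·c_∞`
    have hodd : ¬ Even (p / 2) := by rw [Nat.not_even_iff_odd]; exact ⟨p / 4, by omega⟩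
    have hCW' : ∃ C : VariableChange ℚ, C • V₁.quadraticTwist (-(p : ℚ)) = E₁ := by
      rw [pStar_eq_neg_of_mod_four_eq_three hp3] at hCW; exact hCW
    obtain ⟨C, hC⟩ := hCW'
    rw [if_neg hodd] at hϖ
    obtain ⟨ε, hε, hLε⟩ := entireLFunction_one_eq_of_twist_neg p hmod hp3 V₁ E₁ C hC hadd hf ϖ hϖ
    set cinf : ℕ := (E₁.baseChange ℝ).numRealComponents with hcinf
    have hua0 : |(C.u : ℚ)| ≠ 0 := abs_ne_zero.mpr C.u.ne_zero
    have hcinf0 : (cinf : ℚ) ≠ 0 := by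
      rw [hcinf, numRealComponents]
      split_ifs <;> norm_num
    have hu : padicValRat p (C.u : ℚ) = 0 :=
      padicValRat_u_eq_zero_of_twist_pm_p p hp2 V₁ E₁ hV (d := -(p : ℤ)) (Or.inr rfl) C
        (by push_cast; exact hC)
    have hvua : padicValRat p |(C.u : ℚ)| = 0 := by
      rcases abs_choice (C.u : ℚ) with h | h
      · rw [h, hu]
      · rw [h, padicValRat.neg, hu]
    have hm0 : |(C.u : ℚ)| * (cinf : ℚ) ≠ 0 := mul_ne_zero hua0 hcinf0
    have hvm : padicValRat p (|(C.u : ℚ)| * (cinf : ℚ)) = 0 := by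
      rw [padicValRat.mul hua0 hcinf0, hvua, hcinf, padicValRat_numRealComponents_eq_zero E₁ p hp2,
        add_zero]
    -- `q · m = ε ϖ S⁻`
    have hqε : q * (|(C.u : ℚ)| * (cinf : ℚ)) = ε * (ϖ * legendreMinusSymbolSum f p) := by
      have h1 : ((q : ℂ)) =
          ((ε * (ϖ * legendreMinusSymbolSum f p) / (|(C.u : ℚ)| * (cinf : ℚ)) : ℚ) : ℂ) :=
        mul_right_cancel₀ hΩ (hq.symm.trans hLε)
      have h2 : q = ε * (ϖ * legendreMinusSymbolSum f p) / (|(C.u : ℚ)| * (cinf : ℚ)) := by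
        exact_mod_cast h1
      rw [h2, div_mul_cancel₀ _ hm0]
    have hε0 : ε ≠ 0 := by rcases hε with rfl | rfl <;> norm_num
    have hvε : padicValRat p ε = 0 := by
      rcases hε with rfl | rfl
      · exact padicValRat.one
      · rw [← padicValRat.neg, neg_neg]; exact padicValRat.one
    have hϖS0 : (ϖ * legendreMinusSymbolSum f p : ℚ) ≠ 0 := by
      intro hz
      rw [hz, mul_zero] at hqε
      exact (mul_ne_zero hq0 hm0) hqε
    refine ⟨legendreMinusSymbolSum f p, by rw [if_neg hodd], hϖS0, ?_⟩
    have h := congrArg (padicValRat p) hqε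
    rw [padicValRat.mul hq0 hm0, hvq, hvm, zero_add, padicValRat.mul hε0 hϖS0, hvε, zero_add] at h
    exact h.symm

/-! ## §2 The Λ-adic input at a congruent curve from a partner certified by (C1) + (C2′) -/

/-- **`QuadraticBranchLowerDivisibilityAt V p` (`p ≥ 5`) from Kato's half-eigen divisibility, EPW's
semistable branch transfer, Pal, modularity, and a PARTNER certified by (C1) + (C2′).** The partner: `V₁`
globally minimal, good ordinary or multiplicative at `p`, `ρ_{V₁,pⁿ}` onto for all `n`, with its globally
minimal `p*`-twist `E₁` (additive at `p`) of analytic rank `0` and `ord_p (L(E₁,1)/Ω_{E₁}) = 0`; (C1): a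
`Γ_ℚ`-equivariant `V₁[p] ≃ V[p]`. For the multiplicative twist model `V` of a cell-(M) curve this is child
19590 `MultLambdaLower` AT THE PAIR. CONDITIONAL on the displayed facts and certificates; closes nothing.
[cite: EmertonPollackWeston2006, Cor. 5.1.4 (arXiv p30), Ex. 5.3.1 (p32)] [cite: Kato2004Asterisque, Thm. 12.5 (4) (p. 222)]
[cite: MazurTateTeitelbaum1986Invent, §I.14] [cite: Pal2012, Thm. 3.2] -/
theorem quadraticBranchLowerDivisibilityAt_of_partner_LValueUnit
    (hKW : Wuthrich2014.kato_halfEigenCharIdeal_dvd_cyclotomicPrime_of_surjective)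
    (hEPW : EmertonPollackWeston2006.cor514_branchTransfer_semistable_of_torsionIso)
    (hPal : Pal2012.thm32_sqrt_mul_realPeriodRat_twist_eq_of_prime_one_mod_four)
    (hmod : hasEntireLFunction_rat) (hp5 : 5 ≤ p)
    (V₁ E₁ : WeierstrassCurve ℚ) [V₁.IsElliptic] [V₁.IsGloballyMinimal] [E₁.IsElliptic]
    [E₁.IsGloballyMinimal]
    (hCW₁ : ∃ C : VariableChange ℚ, C • V₁.quadraticTwist ((-1) ^ (p / 2) * p : ℚ) = E₁)
    (hred₁ : IsOrdinaryAt V₁ p ∨ V₁.HasMultiplicativeReductionAtPrime p)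
    (hsurj₁ : ∀ n : ℕ, V₁.HasSurjectiveModNGaloisRep (p ^ n : ℕ))
    (hadd₁ : Addv E₁ p) (hr₁ : E₁.analyticRank = 0)
    (hL₁ : ∃ q : ℚ, E₁.entireLFunction 1 = (q : ℂ) * (E₁.realPeriodRat : ℂ) ∧ padicValRat p q = 0)
    (V : WeierstrassCurve ℚ) [V.IsElliptic] [V.IsGloballyMinimal]
    (hiso : ∃ e : geomTorsion V₁ (p : ℤ) ≃+ geomTorsion V (p : ℤ),
      ∀ (σ : Field.absoluteGaloisGroup ℚ) (P : geomTorsion V₁ (p : ℤ)), e (σ • P) = σ • e P) :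
    QuadraticBranchLowerDivisibilityAt V p :=
  have hp2 : p ≠ 2 := by omega
  quadraticBranchLowerDivisibilityAt_of_partner hKW hEPW hp5 V₁ hred₁ hsurj₁
    (fun f B hf hB ϖ hϖ =>
      norm_constantCoeff_halfBranch_eq_one_of_LValueUnit hPal hmod hp2 V₁ E₁ hCW₁ hadd₁ hr₁ hL₁ f B hf hB ϖ
        hϖ)
    V hiso

/-! ## §3 The lower half at a cell-(M) pair from a partner certified by (C1) + (C2′) -/

/-- **Cell (M), `p ≥ 5`, `r_an(E) = 0`: `ord_p #Ш(E)_an ≤ ord_p #Ш(E)` from the route's facts, Pal, Kato's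
half-eigen reading, EPW's semistable branch transfer, and a PARTNER certified by (C1) + (C2′).** The
partner: `V₁` globally minimal, good ordinary or multiplicative at `p`, `ρ_{V₁,pⁿ}` onto for all `n`, with
its globally minimal `p*`-twist `E₁` (additive at `p`: a cell-(M) pair if `V₁` is multiplicative, a
cell-(G-ord, `e = 2`) pair if good ordinary) of analytic rank `0` and `ord_p (L(E₁,1)/Ω_{E₁}) = 0`; (C1): a
`Γ_ℚ`-equivariant `V₁[p] ≃ V[p]` for the (multiplicative) twist models `V` of `E`. I.e. the lower half
PROPAGATES along a mod-`p` congruence of twist models from an additive pair where it is trivial to the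
cell-(M) pair `(E, p)`. CONDITIONAL on the displayed facts and certificates; closes nothing.
[cite: EmertonPollackWeston2006, Cor. 5.1.4 (arXiv p30), Ex. 5.3.1 (p32)] [cite: Kato2004Asterisque, Thm. 12.5 (4) (p. 222)]
[cite: Pal2012, Thm. 3.2] [cite: Delbourgo1998, Prop. 4 (p. 144), §2.2 Lemma (ii) (p. 139)] [cite: Miller2011LMS, Def. 1.1] -/
theorem missingLowerBoundAt_rankZero_of_cellM_of_partner_LValueUnit {W : WeierstrassCurve ℚ}
    [W.IsElliptic] [W.IsGloballyMinimal]
    (hDelX : Delbourgo1998.prop4_rankZero_constantCoeff_eq_unit_mul_of_potMult)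
    (hPal : Pal2012.thm32_sqrt_mul_realPeriodRat_twist_eq_of_prime_one_mod_four)
    (hGZK : rank_eq_analyticRank_of_analyticRank_le_one) (hmod : hasEntireLFunction_rat)
    (hmodD : nonempty_modularParametrizationData)
    (hKW : Wuthrich2014.kato_halfEigenCharIdeal_dvd_cyclotomicPrime_of_surjective)
    (hEPW : EmertonPollackWeston2006.cor514_branchTransfer_semistable_of_torsionIso)
    (hc : N10.CellM W p) (hp5 : 5 ≤ p) (hr : W.analyticRank = 0)
    (V₁ E₁ : WeierstrassCurve ℚ) [V₁.IsElliptic] [V₁.IsGloballyMinimal] [E₁.IsElliptic]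
    [E₁.IsGloballyMinimal]
    (hCW₁ : ∃ C : VariableChange ℚ, C • V₁.quadraticTwist ((-1) ^ (p / 2) * p : ℚ) = E₁)
    (hred₁ : IsOrdinaryAt V₁ p ∨ V₁.HasMultiplicativeReductionAtPrime p)
    (hsurj₁ : ∀ n : ℕ, V₁.HasSurjectiveModNGaloisRep (p ^ n : ℕ))
    (hadd₁ : Addv E₁ p) (hr₁ : E₁.analyticRank = 0)
    (hL₁ : ∃ q : ℚ, E₁.entireLFunction 1 = (q : ℂ) * (E₁.realPeriodRat : ℂ) ∧ padicValRat p q = 0)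
    (hiso : ∀ (V : WeierstrassCurve ℚ) [V.IsElliptic] [V.IsGloballyMinimal],
      (∃ C : VariableChange ℚ, C • V.quadraticTwist ((-1) ^ (p / 2) * p : ℚ) = W) →
      ∃ e : geomTorsion V₁ (p : ℤ) ≃+ geomTorsion V (p : ℤ),
        ∀ (σ : Field.absoluteGaloisGroup ℚ) (P : geomTorsion V₁ (p : ℤ)), e (σ • P) = σ • e P) :
    MissingLowerBoundAt W p :=
  missingLowerBoundAt_rankZero_of_cellM_of_quadraticBranchLower hDelX hPal hGZK hmod hmodD hc hr
    fun V _ _ hCW =>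
      quadraticBranchLowerDivisibilityAt_of_partner_LValueUnit hKW hEPW hPal hmod hp5 V₁ E₁ hCW₁ hred₁ hsurj₁
        hadd₁ hr₁ hL₁ V (hiso V hCW)

end Summit.BirchSwinnertonDyer.BirchSwinnertonDyer.Theorems.AdditiveBranchIMCMultLowerCongruence

end
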